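import Mathlib
import Summits.Ventures.PercRepro2.Defs
import Summits.Ventures.PercRepro2.Independence
import Summits.Ventures.PercRepro2.Harris
import Summits.Ventures.PercRepro2.Graph
import Summits.Ventures.PercRepro2.Exploration
import Summits.Ventures.PercRepro2.FourFunctions
import Summits.Ventures.PercRepro2.Induced
import Summits.Ventures.PercRepro2.Frontier
import Summits.Ventures.PercRepro2.CaseOneHB1AvoidStepO

/-!
# The two-mark avoidance inequality, the `o`-free variant (blind cell PercRepro2, p1 g36;
proofs/P1-HB1.md §3″)

With the events `L1 X = {s ↔ a, s ↮ X}`, `L2 Y = {s ↔ o, s ↮ a, s ↮ Y, a ↮ Y}`,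
`R1 Z = {s ↔ a, s ↔ o, s ↮ Z}`, `R2 W = {s ↮ a, s ↮ W, a ↮ W}` of CaseOneHB1AvoidStepO.lean:

**Theorem** (`TwoMarkO.twoMark_induced`, `TwoMarkO.twoMark`):
`P(L1 X) · P(L2 Y) ≤ P(R1 (X ∩ Y)) · P(R2 (X ∪ Y))` — the same frontier induction as
CaseOneHB1Avoid.lean (the sources `s` and `a` only). Standard axioms. -/

namespace Summit.Ventures.PercRepro2

namespace TwoMarkO

/-! ## The theorem on induced subgraphs -/

section Main

variable {V : Type*} {E : Type*} [Fintype E] [DecidableEq E] [Fintype V] [DecidableEq V]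
  {R : Type*} [CommRing R] [LinearOrder R] [IsStrictOrderedRing R]

omit [Fintype E] [DecidableEq E] [Fintype V] [DecidableEq V] in
/-- If `s` or `a` lies in `X` then `L1 X` is empty. -/
lemma L1_eq_empty {ends : E → Sym2 V} {U : Finset V} {s a : V} {X : Finset V}
    (h : s ∈ X ∨ a ∈ X) : L1 ends U s a X = ∅ := by
  rcases h with hs | ha
  · rw [L1, REvent_eq_empty_of_mem ends U hs, Set.inter_empty]
  · rw [L1, QEvent_inter_REvent_eq_empty ends U s (Finset.mem_singleton_self a) ha]

omit [Fintype E] [DecidableEq E] [Fintype V] in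
/-- If `s`, `a` or `o` lies in `Y` then `L2 Y` is empty. -/
lemma L2_eq_empty {ends : E → Sym2 V} {U : Finset V} {s a o : V} {Y : Finset V}
    (h : s ∈ Y ∨ a ∈ Y ∨ o ∈ Y) : L2 ends U s a o Y = ∅ := by
  rcases h with hs | ha | ho
  · rw [L2, REvent_eq_empty_of_mem ends U (Finset.mem_union_right _ hs), Set.inter_empty,
      Set.empty_inter]
  · rw [L2, REvent_eq_empty_of_mem ends U ha, Set.inter_empty]
  · rw [L2, QEvent_inter_REvent_eq_empty ends U s (Finset.mem_singleton_self o)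
      (Finset.mem_union_right _ ho), Set.empty_inter]

/-- **The two-mark avoidance inequality on induced subgraphs**: for every vertex set `U` and all
`X, Y ⊆ U`, `P(L1 X) · P(L2 Y) ≤ P(R1 (X ∩ Y)) · P(R2 (X ∪ Y))`. -/
theorem twoMark_induced (p : E → R) (hp : IsProbVec p) (ends : E → Sym2 V) (s a o : V)
    (U : Finset V) :
    ∀ X Y : Finset V, X ⊆ U → Y ⊆ U →
      prob p (L1 ends U s a X) * prob p (L2 ends U s a o Y) ≤
        prob p (R1 ends U s a o (X ∩ Y)) * prob p (R2 ends U s a (X ∪ Y)) := by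
  induction U using Finset.strongInduction with
  | H U ih =>
  intro X Y hX hY
  by_cases hZ : X ∩ Y = ∅
  · exact twoMark_of_inter_eq_empty p hp ends s a o U X Y hZ
  -- the exploration step: `Z = X ∩ Y ≠ ∅`
  set Z := X ∩ Y with hZdef
  have hZX : Z ⊆ X := Finset.inter_subset_left
  have hZY : Z ⊆ Y := Finset.inter_subset_right
  have hZU : Z ⊆ U := hZX.trans hX
  have hRnn : 0 ≤ prob p (R1 ends U s a o Z) * prob p (R2 ends U s a (X ∪ Y)) :=
    mul_nonneg (prob_nonneg hp _) (prob_nonneg hp _)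
  by_cases hsZ : s ∈ Z
  · rw [L1_eq_empty (Or.inl (hZX hsZ)), prob_empty, zero_mul]; exact hRnn
  by_cases haZ : a ∈ Z
  · rw [L1_eq_empty (Or.inr (hZX haZ)), prob_empty, zero_mul]; exact hRnn
  by_cases hoZ : o ∈ Z
  · rw [L2_eq_empty (Or.inr (Or.inr (hZY hoZ))), prob_empty, mul_zero]; exact hRnn
  have hU' : U \ Z ⊂ U := Finset.sdiff_ssubset hZU (Finset.nonempty_iff_ne_empty.2 hZ)
  have hZXY : Z ⊆ X ∪ Y := hZX.trans Finset.subset_union_left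
  -- the four terms as sums over configurations (domain Markov identity)
  rw [prob_L1_eq p ends hZU hsZ hZX, prob_L2_eq p ends hZU hsZ haZ hZY,
    prob_R1_eq p ends hZU hsZ, prob_R2_eq p ends hZU hsZ haZ hZXY]
  -- the four functions theorem on the lattice `Config E`
  refine four_functions_theorem_univ
    (fun ω => weight p ω * prob p (L1 ends (U \ Z) s a ((X \ Z) ∪ frontier ends U Z ω)))
    (fun ω => weight p ω * prob p (L2 ends (U \ Z) s a o ((Y \ Z) ∪ frontier ends U Z ω)))
    (fun ω => weight p ω * prob p (R1 ends (U \ Z) s a o (frontier ends U Z ω)))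
    (fun ω => weight p ω * prob p (R2 ends (U \ Z) s a
      (((X ∪ Y) \ Z) ∪ frontier ends U Z ω)))
    (fun ω => mul_nonneg (weight_nonneg hp ω) (prob_nonneg hp _))
    (fun ω => mul_nonneg (weight_nonneg hp ω) (prob_nonneg hp _))
    (fun ω => mul_nonneg (weight_nonneg hp ω) (prob_nonneg hp _))
    (fun ω => mul_nonneg (weight_nonneg hp ω) (prob_nonneg hp _)) ?_
  intro ω ω'
  -- induction hypothesis on `U ∖ Z` with the frontiers added to the avoided sets
  have hX'' : (X \ Z) ∪ frontier ends U Z ω ⊆ U \ Z :=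
    Finset.union_subset (Finset.sdiff_subset_sdiff hX (le_refl Z)) (frontier_subset ω)
  have hY'' : (Y \ Z) ∪ frontier ends U Z ω' ⊆ U \ Z :=
    Finset.union_subset (Finset.sdiff_subset_sdiff hY (le_refl Z)) (frontier_subset ω')
  have hIH := ih (U \ Z) hU' ((X \ Z) ∪ frontier ends U Z ω) ((Y \ Z) ∪ frontier ends U Z ω')
    hX'' hY''
  -- `S(ω ⊓ ω') ⊆ S(ω) ∩ S(ω') ⊆ X'' ∩ Y''`
  have h3 : prob p (R1 ends (U \ Z) s a o
      (((X \ Z) ∪ frontier ends U Z ω) ∩ ((Y \ Z) ∪ frontier ends U Z ω'))) ≤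
      prob p (R1 ends (U \ Z) s a o (frontier ends U Z (ω ⊓ ω'))) := by
    refine prob_mono hp (R1_anti ?_)
    exact (frontier_inf_subset ω ω').trans
      (Finset.inter_subset_inter Finset.subset_union_right Finset.subset_union_right)
  -- `X'' ∪ Y'' = (X ∪ Y) ∖ Z ∪ S(ω ⊔ ω')`
  have h4 : prob p (R2 ends (U \ Z) s a
      (((X \ Z) ∪ frontier ends U Z ω) ∪ ((Y \ Z) ∪ frontier ends U Z ω'))) =
      prob p (R2 ends (U \ Z) s a (((X ∪ Y) \ Z) ∪ frontier ends U Z (ω ⊔ ω'))) := by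
    rw [frontier_sup, Finset.union_sdiff_distrib]
    congr 2
    ext x
    simp only [Finset.mem_union]
    tauto
  calc weight p ω * prob p (L1 ends (U \ Z) s a ((X \ Z) ∪ frontier ends U Z ω)) *
        (weight p ω' * prob p (L2 ends (U \ Z) s a o ((Y \ Z) ∪ frontier ends U Z ω')))
      = (weight p ω * weight p ω') *
          (prob p (L1 ends (U \ Z) s a ((X \ Z) ∪ frontier ends U Z ω)) *
          prob p (L2 ends (U \ Z) s a o ((Y \ Z) ∪ frontier ends U Z ω'))) := by ring
    _ ≤ (weight p ω * weight p ω') *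
          (prob p (R1 ends (U \ Z) s a o (frontier ends U Z (ω ⊓ ω'))) *
          prob p (R2 ends (U \ Z) s a (((X ∪ Y) \ Z) ∪ frontier ends U Z (ω ⊔ ω')))) :=
        mul_le_mul_of_nonneg_left
          (hIH.trans (mul_le_mul h3 (le_of_eq h4) (prob_nonneg hp _) (prob_nonneg hp _)))
          (mul_nonneg (weight_nonneg hp ω) (weight_nonneg hp ω'))
    _ = weight p (ω ⊓ ω') * prob p (R1 ends (U \ Z) s a o (frontier ends U Z (ω ⊓ ω'))) *
        (weight p (ω ⊔ ω') * prob p (R2 ends (U \ Z) s a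
          (((X ∪ Y) \ Z) ∪ frontier ends U Z (ω ⊔ ω')))) := by
        rw [← weight_inf_mul_weight_sup p ω ω']
        ring

end Main

/-! ## The theorem on the whole graph -/

section Whole

variable {V : Type*} {E : Type*} [Fintype E] [DecidableEq E] [Fintype V] [DecidableEq V]
  {R : Type*} [CommRing R] [LinearOrder R] [IsStrictOrderedRing R]

omit [Fintype E] [DecidableEq E] [DecidableEq V] in
/-- On `U = univ` the induced connections are the connections. -/
lemma conn_induced_univ (ends : E → Sym2 V) (ω : Config E) (u v : V) :
    Conn ends (induced ends (↑(Finset.univ : Finset V)) ω) u v ↔ Conn ends ω u v := by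
  rw [Finset.coe_univ, induced_univ]

/-- **The two-mark avoidance inequality**: for a source `s`, marks `a, o` and vertex sets `X, Y`
of a finite graph,
`P(s↔a, s↮o, s↮X, o↮X) · P(s↔o, s↮a, s↮Y, a↮Y) ≤ P(s↔a, s↔o, s↮X∩Y) · P(s, a, o, X∪Y pairwise ↮)`,
stated with the induced events at `U = univ`. -/
theorem twoMark (p : E → R) (hp : IsProbVec p) (ends : E → Sym2 V) (s a o : V) (X Y : Finset V) :
    prob p (L1 ends Finset.univ s a X) * prob p (L2 ends Finset.univ s a o Y) ≤
      prob p (R1 ends Finset.univ s a o (X ∩ Y)) * prob p (R2 ends Finset.univ s a (X ∪ Y)) :=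
  twoMark_induced p hp ends s a o Finset.univ X Y (Finset.subset_univ X) (Finset.subset_univ Y)

end Whole

end TwoMarkO

end Summit.Ventures.PercRepro2
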